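import Mathlib
import Literature.Analysis.FluidPDE.SpaceTimeCalculus
import HarnessLib

/-!
# Route `TautLoopKelvin`, crux `TautLoopLaw` (stmt-NavierStokesRegularity-15249), line
  `Sketch-ideas-r1k1` (Dini–Saks architecture) — auxiliary tools stub `stub_tautLoopVanAux`
  serving the tools stub `stub_tautLoopStepVanishingOrderTools` (uniform finite vanishing order)

Pure analysis lemmas behind the uniform finite vanishing order of a jointly smooth, slice-wise
real-analytic field:

* `tautLoopVan_iteratedDeriv_line`: the iterated derivatives of the restriction of a smooth `g` to
  a line `τ ↦ x + τ • e` are the iterated directional derivatives `(∂_e)^k g` along the line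
  (chain rule, induction on `k`);
* `tautLoopVan_isSmoothSpaceTimeOn_iterate`: for a jointly smooth field `w` on `S × X` (`S` of
  unique differentiability) the fields `(t, x) ↦ ((∂_e)^k (w t)) x` are jointly smooth (the tree's
  `IsSmoothSpaceTimeOn.fderiv_slice`, iterated), hence jointly continuous;
* `tautLoopVan_exists_direction`: a real-analytic `g ≢ 0` has at every point a direction `e`,
  `‖e‖ ≤ 1`, and an order `m` with `(d/dτ)^m g(x + τ e)|_{τ=0} ≠ 0` (identity principle on the line
  through a point where `g ≠ 0`: Mathlib's `natCast_le_analyticOrderAt_iff_iteratedDeriv_eq_zero`,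
  `analyticOrderAt_eq_top`, `AnalyticOnNhd.eqOn_zero_of_preconnected_of_eventuallyEq_zero`);
* `tautLoopVan_line_lower_bound`: the quantitative one-variable estimate — if `‖f⁽ᵐ⁾(0)‖ ≥ c₀` and
  `‖f⁽ᵐ⁺¹⁾‖ ≤ M` on `[0, 1]` then `max_{k ≤ m} ‖f(k d/(m+1))‖ ≥ C d^m` for `0 < d ≤ D`, with
  `C, D > 0` depending only on `(m, c₀, M)`: the `m`-th finite difference of the degree-`m` Taylor
  polynomial is `δ^m f⁽ᵐ⁾(0)` (binomial alternating sums `Σ_k (-1)^{m-k} C(m,k) k^j = m! [j = m]`,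
  `j ≤ m`, from Mathlib's `fwdDiff_iter_eq_sum_shift`, `fwdDiff_iter_eq_factorial`,
  `fwdDiff_iter_pow_eq_zero_of_lt`), and the Taylor remainder (`taylor_mean_remainder_bound`) is
  `O(d^{m+1})`.

Everything is folklore calculus; the last theorem packages the four statements (specialised to
`ℝ³`-valued fields on `ℝ³`) as the registered auxiliary tools stub.
-/

noncomputable section

open Set Function Filter Topology
open scoped ContDiff Nat

namespace Summit.NavierStokesRegularity.NavierStokesRegularity.Theorems

set_option linter.dupNamespace false

open Literature.Analysis.FluidPDE (IsSmoothSpaceTimeOn)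

variable {X : Type*} [NormedAddCommGroup X] [NormedSpace ℝ X]
variable {F : Type*} [NormedAddCommGroup F] [NormedSpace ℝ F]

/-- Iterated derivatives of the restriction of a smooth `g` to the line `τ ↦ x + τ • e` are the
iterated directional derivatives `(∂_e)^k g` along the line. [folklore] -/
theorem tautLoopVan_iteratedDeriv_line (e : X) :
    ∀ (k : ℕ) {g : X → F}, ContDiff ℝ ∞ g → ∀ (x : X) (t : ℝ),
      iteratedDeriv k (fun τ : ℝ => g (x + τ • e)) t =
        ((fun v : X → F => fun y => fderiv ℝ v y e)^[k] g) (x + t • e)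
  | 0, g, _, x, t => by simp
  | k + 1, g, hg, x, t => by
    have hd : deriv (fun τ : ℝ => g (x + τ • e)) = fun τ => fderiv ℝ g (x + τ • e) e := by
      funext τ
      have h1 : HasDerivAt (fun τ : ℝ => x + τ • e) e τ := by
        simpa using ((hasDerivAt_id τ).smul_const e).const_add x
      have h2 : HasFDerivAt g (fderiv ℝ g (x + τ • e)) (x + τ • e) :=
        ((hg.differentiable (by simp)) _).hasFDerivAt
      exact (h2.comp_hasDerivAt τ h1).deriv
    have hg' : ContDiff ℝ ∞ (fun y => fderiv ℝ g y e) :=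
      (contDiff_infty_iff_fderiv.1 hg).2.clm_apply contDiff_const
    rw [iteratedDeriv_succ', hd, Function.iterate_succ_apply]
    exact tautLoopVan_iteratedDeriv_line e k hg' x t

/-- The iterated directional slice derivatives `(t, x) ↦ ((∂_e)^k (w t)) x` of a jointly smooth
field (time set of unique differentiability) form a jointly smooth field. [folklore] -/
theorem tautLoopVan_isSmoothSpaceTimeOn_iterate {S : Set ℝ} {w : ℝ → X → F}
    (h : IsSmoothSpaceTimeOn S w) (hS : UniqueDiffOn ℝ S) (e : X) :
    ∀ k : ℕ, IsSmoothSpaceTimeOn S (fun t => (fun v : X → F => fun y => fderiv ℝ v y e)^[k] (w t))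
  | 0 => by simpa using h
  | k + 1 => by
    have ih := tautLoopVan_isSmoothSpaceTimeOn_iterate h hS e k
    have hc : IsSmoothSpaceTimeOn S (fun (_ : ℝ) (_ : X) => e) := contDiffOn_const
    have := (ih.fderiv_slice hS).clm_apply hc
    simpa only [Function.iterate_succ_apply'] using this

/-- A real-analytic function on `ℝ` which does not vanish identically has a non-zero iterated
derivative at `0` (identity principle). [folklore] -/
theorem tautLoopVan_exists_iteratedDeriv_ne_zero [CompleteSpace F] {q : ℝ → F}
    (hq : AnalyticOnNhd ℝ q univ) {τ₀ : ℝ} (h0 : q τ₀ ≠ 0) :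
    ∃ m : ℕ, iteratedDeriv m q 0 ≠ 0 := by
  by_contra! h
  have htop : analyticOrderAt q 0 = ⊤ := by
    refine ENat.eq_top_iff_forall_ge.2 fun m => ?_
    exact (natCast_le_analyticOrderAt_iff_iteratedDeriv_eq_zero (hq 0 (mem_univ _))).2
      fun i _ => h i
  rw [analyticOrderAt_eq_top] at htop
  have := hq.eqOn_zero_of_preconnected_of_eventuallyEq_zero isPreconnected_univ (mem_univ 0)
    htop (mem_univ τ₀)
  exact h0 this

/-- Pointwise finite directional vanishing order: a real-analytic `g` on `X` which is not
identically zero has, at every point `x`, a direction `e` with `‖e‖ ≤ 1` and an order `m` with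
`(d/dτ)^m g(x + τ e)|_{τ=0} ≠ 0`. [folklore] -/
theorem tautLoopVan_exists_direction [CompleteSpace F] {g : X → F} (hg : AnalyticOnNhd ℝ g univ)
    {y : X} (hy : g y ≠ 0) (x : X) :
    ∃ (m : ℕ) (e : X), ‖e‖ ≤ 1 ∧ iteratedDeriv m (fun τ : ℝ => g (x + τ • e)) 0 ≠ 0 := by
  set e : X := ‖y - x‖⁻¹ • (y - x) with he
  have hline : AnalyticOnNhd ℝ (fun τ : ℝ => g (x + τ • e)) univ := by
    intro τ _
    refine (hg _ (mem_univ _)).comp ?_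
    exact analyticAt_const.add (analyticAt_id.smul analyticAt_const)
  have hval : (fun τ : ℝ => g (x + τ • e)) ‖y - x‖ ≠ 0 := by
    by_cases hxy : y - x = 0
    · have : y = x := by rwa [sub_eq_zero] at hxy
      simpa [this] using hy
    · have hn : ‖y - x‖ ≠ 0 := by simpa using hxy
      simp only [he, smul_smul, mul_inv_cancel₀ hn, one_smul, add_sub_cancel]
      exact hy
  obtain ⟨m, hm⟩ := tautLoopVan_exists_iteratedDeriv_ne_zero hline hval
  refine ⟨m, e, ?_, hm⟩
  rw [he, norm_smul, norm_inv, norm_norm]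
  exact inv_mul_le_one

/-- The binomial alternating sums `Σ_k (-1)^{m-k} C(m,k) k^j` vanish for `j < m` and equal `m!`
for `j = m` (iterated forward differences of monomials, Mathlib's `fwdDiff_iter_eq_factorial`,
`fwdDiff_iter_pow_eq_zero_of_lt`). [folklore] -/
theorem tautLoopVan_sum_choose_mul_pow (m : ℕ) {j : ℕ} (hj : j ≤ m) :
    ∑ k ∈ Finset.range (m + 1), ((-1 : ℝ) ^ (m - k) * (m.choose k : ℝ)) * (k : ℝ) ^ j =
      if j = m then (m ! : ℝ) else 0 := by
  have h := fwdDiff_iter_eq_sum_shift (1 : ℝ) (fun r : ℝ => r ^ j) m 0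
  have h2 : ∑ k ∈ Finset.range (m + 1), ((-1 : ℝ) ^ (m - k) * (m.choose k : ℝ)) * (k : ℝ) ^ j
      = ((fwdDiff (1 : ℝ))^[m] (fun r : ℝ => r ^ j)) 0 := by
    rw [h]
    refine Finset.sum_congr rfl fun k _ => ?_
    rw [zsmul_eq_mul]
    push_cast
    ring
  rw [h2]
  split_ifs with hjm
  · subst hjm
    rw [fwdDiff_iter_eq_factorial]
    simp
  · rw [fwdDiff_iter_pow_eq_zero_of_lt (lt_of_le_of_ne hj hjm)]
    simp

/-- Norm of a binomial alternating sum: `‖Σ_k (-1)^{m-k} C(m,k) v_k‖ ≤ 2^m max ‖v_k‖`. [folklore] -/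
theorem tautLoopVan_norm_alt_sum_le (m : ℕ) {v : ℕ → F} {B : ℝ}
    (hv : ∀ k ∈ Finset.range (m + 1), ‖v k‖ ≤ B) :
    ‖∑ k ∈ Finset.range (m + 1), ((-1 : ℝ) ^ (m - k) * (m.choose k : ℝ)) • v k‖ ≤ 2 ^ m * B := by
  calc ‖∑ k ∈ Finset.range (m + 1), ((-1 : ℝ) ^ (m - k) * (m.choose k : ℝ)) • v k‖
      ≤ ∑ k ∈ Finset.range (m + 1), ‖((-1 : ℝ) ^ (m - k) * (m.choose k : ℝ)) • v k‖ :=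
        norm_sum_le _ _
    _ ≤ ∑ k ∈ Finset.range (m + 1), (m.choose k : ℝ) * B := by
        refine Finset.sum_le_sum fun k hk => ?_
        rw [norm_smul, norm_mul, norm_pow, norm_neg, norm_one, one_pow, one_mul,
          Real.norm_natCast]
        exact mul_le_mul_of_nonneg_left (hv k hk) (Nat.cast_nonneg _)
    _ = 2 ^ m * B := by
        rw [← Finset.sum_mul, ← Nat.cast_sum, Nat.sum_range_choose]
        push_cast
        ring

/-- The `m`-th finite difference (step `δ`, at `0`) of a vector-valued Taylor polynomial
`Σ_{j ≤ m} (t^j / j!) a_j` is `δ^m a_m`: finite differences kill the lower-order terms. [folklore] -/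
theorem tautLoopVan_alt_sum_taylor (m : ℕ) (a : ℕ → F) (δ : ℝ) :
    ∑ k ∈ Finset.range (m + 1), ((-1 : ℝ) ^ (m - k) * (m.choose k : ℝ)) •
      ∑ j ∈ Finset.range (m + 1), (((j ! : ℝ))⁻¹ * ((k : ℝ) * δ) ^ j) • a j = δ ^ m • a m := by
  have hD := fun j (hj : j ≤ m) => tautLoopVan_sum_choose_mul_pow m hj
  calc ∑ k ∈ Finset.range (m + 1), ((-1 : ℝ) ^ (m - k) * (m.choose k : ℝ)) •
      ∑ j ∈ Finset.range (m + 1), (((j ! : ℝ))⁻¹ * ((k : ℝ) * δ) ^ j) • a j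
      = ∑ k ∈ Finset.range (m + 1), ∑ j ∈ Finset.range (m + 1),
          (((-1 : ℝ) ^ (m - k) * (m.choose k : ℝ)) * (((j ! : ℝ))⁻¹ * ((k : ℝ) * δ) ^ j)) • a j := by
        refine Finset.sum_congr rfl fun k _ => ?_
        rw [Finset.smul_sum]
        refine Finset.sum_congr rfl fun j _ => ?_
        rw [smul_smul]
    _ = ∑ j ∈ Finset.range (m + 1), ∑ k ∈ Finset.range (m + 1),
          (((-1 : ℝ) ^ (m - k) * (m.choose k : ℝ)) * (((j ! : ℝ))⁻¹ * ((k : ℝ) * δ) ^ j)) • a j :=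
        Finset.sum_comm
    _ = ∑ j ∈ Finset.range (m + 1), ((((j ! : ℝ))⁻¹ * δ ^ j) *
          ∑ k ∈ Finset.range (m + 1), ((-1 : ℝ) ^ (m - k) * (m.choose k : ℝ)) * (k : ℝ) ^ j) • a j := by
        refine Finset.sum_congr rfl fun j _ => ?_
        rw [← Finset.sum_smul, Finset.mul_sum]
        congr 1
        refine Finset.sum_congr rfl fun k _ => ?_
        ring
    _ = ∑ j ∈ Finset.range (m + 1), ((((j ! : ℝ))⁻¹ * δ ^ j) *
          (if j = m then (m ! : ℝ) else 0)) • a j := by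
        refine Finset.sum_congr rfl fun j hj => ?_
        rw [hD j (Nat.lt_succ_iff.mp (Finset.mem_range.mp hj))]
    _ = δ ^ m • a m := by
        simp only [mul_ite, mul_zero, ite_smul, zero_smul, Finset.sum_ite_eq', Finset.mem_range,
          Nat.lt_succ_iff, le_refl, if_true]
        congr 1
        have : (m ! : ℝ) ≠ 0 := by positivity
        field_simp

/-- **Quantitative lower bound on a line.** If `f : ℝ → F` is smooth with `‖f⁽ᵐ⁾(0)‖ ≥ c₀ > 0`
and `‖f⁽ᵐ⁺¹⁾‖ ≤ M` on `[0, 1]`, then for all small `d > 0` one of the `m + 1` equally spaced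
points `k d/(m+1)`, `k ≤ m`, of `[0, d]` satisfies `‖f‖ ≥ C d^m`, with `C, D > 0` depending only
on `m, c₀, M` (finite differences of the Taylor polynomial plus the Taylor remainder bound). [folklore] -/
theorem tautLoopVan_line_lower_bound (m : ℕ) {c₀ M : ℝ} (hc₀ : 0 < c₀) (hM : 0 ≤ M) :
    ∃ C : ℝ, 0 < C ∧ ∃ D : ℝ, 0 < D ∧ D ≤ 1 ∧ ∀ f : ℝ → F, ContDiff ℝ ∞ f →
      c₀ ≤ ‖iteratedDeriv m f 0‖ → (∀ t ∈ Icc (0 : ℝ) 1, ‖iteratedDeriv (m + 1) f t‖ ≤ M) →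
      ∀ d : ℝ, 0 < d → d ≤ D →
        ∃ k ∈ Finset.range (m + 1), C * d ^ m ≤ ‖f ((k : ℝ) * (d / (m + 1)))‖ := by
  set P : ℝ := ((m : ℝ) + 1) ^ m with hP
  set T : ℝ := (2 : ℝ) ^ m with hT
  have hPpos : 0 < P := by positivity
  have hTpos : 0 < T := by positivity
  refine ⟨c₀ / (4 * P * T), by positivity, min 1 (c₀ * m ! / (2 * P * T * M + 1)),
    lt_min one_pos (by positivity), min_le_left _ _, ?_⟩
  intro f hf hc hMb d hd hdD
  have hd1 : d ≤ 1 := hdD.trans (min_le_left _ _)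
  have hd2 : d ≤ c₀ * m ! / (2 * P * T * M + 1) := hdD.trans (min_le_right _ _)
  set δ : ℝ := d / (m + 1) with hδ
  have hδpos : 0 < δ := by positivity
  have hpt : ∀ k ∈ Finset.range (m + 1), 0 ≤ (k : ℝ) * δ ∧ (k : ℝ) * δ ≤ d := by
    intro k hk
    refine ⟨by positivity, ?_⟩
    have hk' : (k : ℝ) ≤ m := by exact_mod_cast Nat.lt_succ_iff.mp (Finset.mem_range.mp hk)
    rw [hδ, mul_div_assoc', div_le_iff₀ (by positivity)]
    nlinarith
  set a : ℕ → F := fun j => iteratedDeriv j f 0 with ha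
  -- Taylor remainder at the sample points
  have htaylor : ∀ k ∈ Finset.range (m + 1),
      ‖f ((k : ℝ) * δ) - ∑ j ∈ Finset.range (m + 1), (((j ! : ℝ))⁻¹ * ((k : ℝ) * δ) ^ j) • a j‖
        ≤ M * d ^ (m + 1) / m ! := by
    intro k hk
    obtain ⟨h0, h1⟩ := hpt k hk
    have hx : (k : ℝ) * δ ∈ Icc (0 : ℝ) 1 := ⟨h0, h1.trans hd1⟩
    have hcd : ContDiffOn ℝ (m + 1) f (Icc 0 1) := by
      have := (contDiff_infty.1 hf (m + 1)).contDiffOn (s := Icc 0 1)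
      exact_mod_cast this
    have hT := taylor_mean_remainder_bound (f := f) (a := 0) (b := 1) (C := M) (x := k * δ)
      (n := m) zero_le_one hcd hx ?_
    · rw [taylor_within_apply] at hT
      have hsum : ∑ j ∈ Finset.range (m + 1), ((j ! : ℝ)⁻¹ * ((k : ℝ) * δ - 0) ^ j) •
            iteratedDerivWithin j f (Icc 0 1) 0
          = ∑ j ∈ Finset.range (m + 1), ((j ! : ℝ)⁻¹ * ((k : ℝ) * δ) ^ j) • a j := by
        refine Finset.sum_congr rfl fun j _ => ?_
        rw [sub_zero, iteratedDerivWithin_eq_iteratedDeriv (uniqueDiffOn_Icc zero_lt_one)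
          (contDiff_infty.1 hf j).contDiffAt (left_mem_Icc.2 zero_le_one)]
      rw [hsum] at hT
      refine hT.trans ?_
      rw [sub_zero]
      gcongr
    · intro y hy
      rw [iteratedDerivWithin_eq_iteratedDeriv (uniqueDiffOn_Icc zero_lt_one)
        (contDiff_infty.1 hf (m + 1)).contDiffAt hy]
      exact hMb y hy
  have hE := tautLoopVan_alt_sum_taylor m a δ
  by_contra hcon
  push Not at hcon
  have hA : ‖∑ k ∈ Finset.range (m + 1), ((-1 : ℝ) ^ (m - k) * (m.choose k : ℝ)) •
      f ((k : ℝ) * δ)‖ ≤ 2 ^ m * (c₀ / (4 * P * T) * d ^ m) :=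
    tautLoopVan_norm_alt_sum_le m fun k hk => (hcon k hk).le
  have hR : ‖∑ k ∈ Finset.range (m + 1), ((-1 : ℝ) ^ (m - k) * (m.choose k : ℝ)) •
      (f ((k : ℝ) * δ) - ∑ j ∈ Finset.range (m + 1), (((j ! : ℝ))⁻¹ * ((k : ℝ) * δ) ^ j) • a j)‖
        ≤ 2 ^ m * (M * d ^ (m + 1) / m !) :=
    tautLoopVan_norm_alt_sum_le m htaylor
  have hsplit : ∑ k ∈ Finset.range (m + 1), ((-1 : ℝ) ^ (m - k) * (m.choose k : ℝ)) •
      f ((k : ℝ) * δ) = δ ^ m • a m + ∑ k ∈ Finset.range (m + 1),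
        ((-1 : ℝ) ^ (m - k) * (m.choose k : ℝ)) • (f ((k : ℝ) * δ) -
          ∑ j ∈ Finset.range (m + 1), (((j ! : ℝ))⁻¹ * ((k : ℝ) * δ) ^ j) • a j) := by
    rw [← hE, ← Finset.sum_add_distrib]
    refine Finset.sum_congr rfl fun k _ => ?_
    rw [← smul_add, add_sub_cancel]
  have hlow : δ ^ m * c₀ - 2 ^ m * (M * d ^ (m + 1) / m !) ≤
      2 ^ m * (c₀ / (4 * P * T) * d ^ m) := by
    refine le_trans ?_ hA
    rw [hsplit]
    set S := ∑ k ∈ Finset.range (m + 1),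
        ((-1 : ℝ) ^ (m - k) * (m.choose k : ℝ)) • (f ((k : ℝ) * δ) -
          ∑ j ∈ Finset.range (m + 1), (((j ! : ℝ))⁻¹ * ((k : ℝ) * δ) ^ j) • a j) with hS
    have htri : ‖δ ^ m • a m‖ - ‖S‖ ≤ ‖δ ^ m • a m + S‖ := by
      have := norm_sub_norm_le (δ ^ m • a m) (-S)
      rwa [norm_neg, sub_neg_eq_add] at this
    refine le_trans ?_ htri
    rw [norm_smul, Real.norm_of_nonneg (by positivity)]
    gcongr
  -- arithmetic
  have hδm : δ ^ m = d ^ m / P := by rw [hδ, hP, div_pow]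
  have hu : 0 < d ^ m := by positivity
  have hKM : 2 * P * T * M * d ≤ c₀ * m ! := by
    have h := (le_div_iff₀ (by positivity : (0 : ℝ) < 2 * P * T * M + 1)).1 hd2
    nlinarith [hd.le, hPpos, hTpos, hM]
  rw [hδm, hT] at hlow
  have hmf : (0 : ℝ) < m ! := by positivity
  have key1 : T * (M * d ^ (m + 1) / m !) ≤ c₀ * d ^ m / (2 * P) := by
    have e1 : T * (M * d ^ (m + 1) / m !) = T * M * d * d ^ m / m ! := by rw [pow_succ]; ring
    rw [e1, div_le_div_iff₀ hmf (by positivity)]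
    calc T * M * d * d ^ m * (2 * P) = (2 * P * T * M * d) * d ^ m := by ring
      _ ≤ c₀ * m ! * d ^ m := mul_le_mul_of_nonneg_right hKM hu.le
      _ = c₀ * d ^ m * m ! := by ring
  have key2 : T * (c₀ / (4 * P * T) * d ^ m) = c₀ * d ^ m / (4 * P) := by
    field_simp
  rw [← hT] at hlow
  rw [key2] at hlow
  have key3 : d ^ m / P * c₀ = c₀ * d ^ m / P := by ring
  rw [key3] at hlow
  have : c₀ * d ^ m / P - c₀ * d ^ m / (2 * P) ≤ c₀ * d ^ m / (4 * P) := by linarith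
  have h4 : c₀ * d ^ m / P - c₀ * d ^ m / (2 * P) - c₀ * d ^ m / (4 * P)
      = c₀ * d ^ m / (4 * P) := by field_simp; ring
  have h5 : 0 < c₀ * d ^ m / (4 * P) := by positivity
  linarith

/-- **Auxiliary tools stub `stub_tautLoopVanAux`**: the four lemmas above, specialised to
`ℝ³`-valued fields on `ℝ³` (line derivatives = iterated directional derivatives; joint smoothness
of the iterated directional slice derivatives; pointwise finite directional order of analytic
non-zero functions; the quantitative line estimate). [folklore] -/
theorem stub_tautLoopVanAux : (∀ (e : EuclideanSpace ℝ (Fin 3)) (k : ℕ)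
    (g : EuclideanSpace ℝ (Fin 3) → EuclideanSpace ℝ (Fin 3)), ContDiff ℝ (⊤ : ℕ∞) g →
    ∀ (x : EuclideanSpace ℝ (Fin 3)) (t : ℝ), iteratedDeriv k (fun τ : ℝ => g (x + τ • e)) t =
    ((fun v : EuclideanSpace ℝ (Fin 3) → EuclideanSpace ℝ (Fin 3) => fun y => fderiv ℝ v y e)^[k]
    g) (x + t • e)) ∧ (∀ (S : Set ℝ) (w : ℝ → EuclideanSpace ℝ (Fin 3) → EuclideanSpace ℝ (Fin 3)),
    Literature.Analysis.FluidPDE.IsSmoothSpaceTimeOn S w → UniqueDiffOn ℝ S →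
    ∀ (e : EuclideanSpace ℝ (Fin 3)) (k : ℕ), Literature.Analysis.FluidPDE.IsSmoothSpaceTimeOn S
    (fun t => (fun v : EuclideanSpace ℝ (Fin 3) → EuclideanSpace ℝ (Fin 3) =>
    fun y => fderiv ℝ v y e)^[k] (w t))) ∧ (∀ (g : EuclideanSpace ℝ (Fin 3) →
    EuclideanSpace ℝ (Fin 3)), AnalyticOnNhd ℝ g Set.univ → ∀ (y : EuclideanSpace ℝ (Fin 3)),
    g y ≠ 0 → ∀ x : EuclideanSpace ℝ (Fin 3), ∃ (m : ℕ) (e : EuclideanSpace ℝ (Fin 3)), ‖e‖ ≤ 1 ∧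
    iteratedDeriv m (fun τ : ℝ => g (x + τ • e)) 0 ≠ 0) ∧ (∀ (m : ℕ) (c₀ M : ℝ), 0 < c₀ → 0 ≤ M →
    ∃ C : ℝ, 0 < C ∧ ∃ D : ℝ, 0 < D ∧ D ≤ 1 ∧ ∀ f : ℝ → EuclideanSpace ℝ (Fin 3),
    ContDiff ℝ (⊤ : ℕ∞) f → c₀ ≤ ‖iteratedDeriv m f 0‖ →
    (∀ t ∈ Set.Icc (0 : ℝ) 1, ‖iteratedDeriv (m + 1) f t‖ ≤ M) → ∀ d : ℝ, 0 < d → d ≤ D →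
    ∃ k ∈ Finset.range (m + 1), C * d ^ m ≤ ‖f ((k : ℝ) * (d / (m + 1)))‖) :=
  ⟨fun e k _g hg x t => tautLoopVan_iteratedDeriv_line e k hg x t,
    fun _S _w hw hS e k => tautLoopVan_isSmoothSpaceTimeOn_iterate hw hS e k,
    fun _g hg _y hy x => tautLoopVan_exists_direction hg hy x,
    fun m _c₀ _M hc₀ hM => tautLoopVan_line_lower_bound m hc₀ hM⟩

end Summit.NavierStokesRegularity.NavierStokesRegularity.Theorems

end
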